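/-
Origin: expansion seat `planner-pub-hodgecm-toy2-g7-0`, handover #8 HANDOVER 2026-08-18T14:02:01Z (l.4071) md5 8c323364; rewrite Toy2g7.Cyclo17 (packager row: handed in STATUS without a t30 kit row; RUN 30 addendum) (`HOME/pub-hodgecm-toy2-g7/lean/Toy2g7/F4Fails.lean`, md5 8c323364, 141 lines);
landed by the gen-8 packager in gate run 30 as `HodgeCM/Model/Toy/F4Fails.lean` (import ^import Toy2g7\.Cyclo17[ \t]*$→import HodgeCM.Model.Toy.Cyclo17 ×1).
-/
/-
Origin: unit pub-hodgecm-toy2-g7 (CONSISTENCY seat 2, generation 7), 2026-08-18.  WIP module `Toy2g7.F4Fails`;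
target `HodgeCM/Model/Toy/F4Fails.lean` (import rewrite at landing: `Toy2g7.Cyclo17` ↦ `HodgeCM.Model.Toy.Cyclo17`).
-/
import Mathlib
import Summits.HodgeConjecture.HodgeCM.StubTree.Qw8MilnePosNoH0_2
import Summits.HodgeConjecture.HodgeCM.Model.Toy.Cyclo17

/-!
# F4 fails in the pull-back family model `U♭` — explicitly

`Toy2g7.Cyclo17` shows that in `U♭ = (toyUniverse₃ 1 4).pbMod` built on a CM type of `ℚ(ζ₁₇)` the 28 model axioms, the
face realisation, N1, N2, N3, N4, F5, D, F-H0 hold and `HC_CM` fails, whence `¬ (F4 ∧ F7d-B)` by `COR_CM_of_descentFactsB₄`.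
Here we decide WHICH of the two fails: **F4 `Fact_cupAlg` fails in `U♭`** (`not_fact_cupAlg_pbMod_of_inert`,
`pbUniverse₃_not_fact_cupAlg`).  The argument is the tree's positive-degree Milne theorem
`weightSpace_le_algC_of_lefChar_eq_zero₅` (model axioms + N1 + N2 + F4 + F5 ⇒ every weight space of Lefschetz character
zero is algebraic): the weight `S` = three conjugate pairs on a single CM factor has character zero (`lefChar_threePairs`)
and a weight LINE (`finrank_weightSpace_of_isHodgeWeight`), while on an inert atom outside the full regime the algebraic
classes of `U♭` in codimension 3 vanish (`pbFam_eq_bot_of_inert`).  So F4 for `U♭` would put a nonzero line inside `⊥`.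

Census consequence (`descentFactsB₄_realised_all_but_F4_gysinDescentB`): there is a universe with
`ModelAxioms ∧ RealisationExistsFace ∧ N1 ∧ N2 ∧ N3 ∧ N4 ∧ F5 ∧ D ∧ F-H0 ∧ ¬F4 ∧ ¬HC_CM` — the binder F4 of
`COR_CM_of_descentFactsB₄` is not derivable from the other binders minus F7d-B, with the realisation present.
(Whether F7d-B holds in `U♭` is left open; see `TOY2-G7.md` §4.1.)
-/

noncomputable section

open scoped TensorProduct
open NumberField NumberField.ComplexEmbedding NumberField.InfinitePlace

attribute [local instance] Classical.propDecidable

namespace HodgeCM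

open Literature.AlgebraicGeometry.Motives (CMType)
open CMTypeOps NonGalois

namespace Universe

variable {U : Universe}

/-- **The Lefschetz character of three conjugate pairs vanishes** (`a(Ψ) + a(Ψ̄) = 0` pair by pair). -/
theorem lefChar_threePairs {F : CMField} (Θ : CMType F) {w : Fin 3 → InfinitePlace F} (hw : Function.Injective w) :
    lefChar (fun _ : Fin (0 + 1) => Θ) (fun _ => threePairs w) = 0 := by
  unfold lefChar
  rw [Fin.sum_univ_one]
  show ∑ s ∈ threePairs w, achar (pullType Θ s) = 0
  rw [threePairs, Finset.sum_biUnion (pairwiseDisjoint_pairs hw)]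
  refine Finset.sum_eq_zero fun i _ => ?_
  rw [Finset.sum_pair (conjugate_ne_self _).symm, pullType_conjugate, achar_add_achar_bar]

set_option smartUnfolding false in
/-- **F4 fails in `U♭`** as soon as `U` satisfies the model axioms, N1, N2, F5 and contains an inert CM atom
`A_{(F,Φ)}`, `F` Galois of degree `≥ 6`, of dimension `> 5`. -/
theorem not_fact_cupAlg_pbMod_of_inert (M : U.ModelAxioms) (hN1 : U.Fact_cupExterior) (hN2 : U.Fact_cup_hodge)
    (h5 : U.Fact_cupAssoc) {F : CMField} [IsGalois ℚ F] (h6 : 6 ≤ Module.finrank ℚ F) (Φ : CMType F)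
    (hd : 3 + 2 < U.dim (U.cmProd F (fun _ : Fin (0 + 1) => Φ)))
    (hI : U.Inert (U.cmProd F (fun _ : Fin (0 + 1) => Φ)) 3) : ¬ U.pbMod.Fact_cupAlg := by
  intro h4
  obtain ⟨w, hw⟩ := exists_three_places (F := F) h6
  have hS := isHodgeWeight_threePairs Φ hw
  have h1 : Module.finrank ℂ (U.weightSpace F (fun _ : Fin (0 + 1) => Φ) (fun _ => threePairs w) (2 * 3)) = 1 :=
    finrank_weightSpace_of_isHodgeWeight M hN1 (by norm_num) hS
  -- Milne in positive degree for `U♭` (model axioms, N1, N2, F5 transfer; F4 is the assumption `h4`)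
  have hle := weightSpace_le_algC_of_lefChar_eq_zero₅ (U := U.pbMod) M.pbMod
    ((pbMod_fact_cupExterior_iff (U := U)).mpr hN1) (show U.pbMod.Fact_cup_hodge from hN2) h4
    (show U.pbMod.Fact_cupAssoc from h5) 2 5 (by norm_num) (lefChar_threePairs Φ hw)
  -- the algebraic classes of `U♭` of codimension 3 on the inert atom vanish
  have hbot : U.pbMod.alg (U.cmProd F (fun _ : Fin (0 + 1) => Φ)) 3 = ⊥ := by
    rw [pbMod_alg, pbFam_eq_bot_of_inert (U := U) (by omega) hI, inf_bot_eq]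
  have hzero : U.weightSpace F (fun _ : Fin (0 + 1) => Φ) (fun _ => threePairs w) (2 * 3) = ⊥ := by
    rw [eq_bot_iff]
    intro x hx
    have hx' : x ∈ U.pbMod.weightSpace F (fun _ : Fin (0 + 1) => Φ) (fun _ => threePairs w) (5 + 1) := hx
    have h' : (U.castC (U.cmProd F (fun _ : Fin (0 + 1) => Φ)) (by norm_num : 5 + 1 = 2 * 3)) x ∈
        (U.pbMod.alg (U.cmProd F (fun _ : Fin (0 + 1) => Φ)) 3).baseChange ℂ := by
      have h := hle hx'
      rw [Submodule.mem_comap] at h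
      unfold algC at h
      exact h
    rw [hbot, Submodule.baseChange_bot, Submodule.mem_bot] at h'
    exact (Submodule.mem_bot ℂ).mpr ((LinearEquiv.map_eq_zero_iff _).mp h')
  rw [hzero, finrank_bot] at h1
  exact zero_ne_one h1

/-- The same from `Fact_dimProd` (which computes `dim A_{(F,Φ)} = [F:ℚ]/2`) for `F` Galois of degree `≥ 12`. -/
theorem not_fact_cupAlg_pbMod_of_inert' (M : U.ModelAxioms) (hN1 : U.Fact_cupExterior) (hN2 : U.Fact_cup_hodge)
    (h5 : U.Fact_cupAssoc) (hd : U.Fact_dimProd) {F : CMField} [IsGalois ℚ F] (h12 : 12 ≤ Module.finrank ℚ F)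
    (Φ : CMType F) (hI : U.Inert (U.cmProd F (fun _ : Fin (0 + 1) => Φ)) 3) : ¬ U.pbMod.Fact_cupAlg := by
  have hdim : U.dim (U.cmProd F (fun _ : Fin (0 + 1) => Φ)) = (0 + 1) * F.halfDegree := dim_cmProd M hd F _
  have hdim' : 3 + 2 < U.dim (U.cmProd F (fun _ : Fin (0 + 1) => Φ)) := by
    rw [hdim, CMField.halfDegree]; omega
  exact not_fact_cupAlg_pbMod_of_inert M hN1 hN2 h5 (by omega) Φ hdim' hI

end Universe

end HodgeCM

namespace HodgeCM.ToyG2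

open HodgeCM.Toy
open Literature.AlgebraicGeometry.Motives

/-- **F4 fails in `(toyUniverse₃ 1 4)♭` built on any CM type of `ℚ(ζ₁₇)`.** -/
theorem pbUniverse₃_not_fact_cupAlg : ¬ (toyUniverse₃ 1 4).pbMod.Fact_cupAlg := by
  haveI := cyclo17_isGalois
  have M : (toyUniverse₃ 1 4).ModelAxioms := toyUniverse₃_modelAxioms_all 1 4
  have hN1 : (toyUniverse₃ 1 4).Fact_cupExterior := fact3_cupExterior exteriorHodgeData traceSys (gplOf 1 4)
  have hN2 : (toyUniverse₃ 1 4).Fact_cup_hodge := fact3_cup_hodge traceSys (gplOf 1 4)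
  have h5 : (toyUniverse₃ 1 4).Fact_cupAssoc := fact3_cupAssoc exteriorHodgeData traceSys (gplOf 1 4)
  have hd : (toyUniverse₃ 1 4).Fact_dimProd := fact3_dimProd exteriorHodgeData traceSys (gplOf 1 4)
  have h12 : 12 ≤ Module.finrank ℚ cyclo17 := by rw [cyclo17_finrank]; norm_num
  have hS : (cmObj cyclo17 (HodgeCM.stdCMType cyclo17)).H1Rigid :=
    Obj.h1Rigid_of_typPrimitive (typPrimitive_of_primitive (cyclo17_primitive _))
  exact Universe.not_fact_cupAlg_pbMod_of_inert' M hN1 hN2 h5 hd h12 (HodgeCM.stdCMType cyclo17)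
    (inert_cmProd_of_h1Rigid exteriorHodgeData traceSys (gplOf 1 4) hS (by norm_num) (by omega))

/-- **F4 row of the census with F4 itself failing.**  There is a universe satisfying the 28 model axioms,
`RealisationExistsFace`, N1, N2, N3, N4, F5, D and F-H0 in which F4 `Fact_cupAlg` FAILS and `HC_CM` FAILS. -/
theorem descentFactsB₄_realised_all_but_F4_gysinDescentB :
    ∃ U : Universe, U.ModelAxioms ∧ U.RealisationExistsFace ∧ U.Fact_cupExterior ∧ U.Fact_cup_hodge ∧
      U.Fact_pull_H0 ∧ U.Fact_hodge_F0 ∧ U.Fact_cupAssoc ∧ U.Fact_dimProd ∧ U.Fact_unitH0 ∧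
      ¬ U.Fact_cupAlg ∧ ¬ U.HC_CM := by
  haveI := cyclo17_isGalois
  have h12 : 12 ≤ Module.finrank ℚ cyclo17 := by rw [cyclo17_finrank]; norm_num
  obtain ⟨M, hR, hN1, hN2, hN3, hN4, h5, hd, hu, hHC⟩ := pbUniverse₃_profile h12 (HodgeCM.stdCMType cyclo17)
    (Obj.h1Rigid_of_typPrimitive (typPrimitive_of_primitive (cyclo17_primitive _)))
  exact ⟨_, M, hR, hN1, hN2, hN3, hN4, h5, hd, hu, pbUniverse₃_not_fact_cupAlg, hHC⟩

/-- Census form: F4 is NOT derivable from `ModelAxioms ∧ RealisationExistsFace ∧ N1 ∧ N2 ∧ N3 ∧ N4 ∧ F5 ∧ D ∧ F-H0`. -/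
theorem not_F4_of_others :
    ¬ ∀ U : Universe, U.ModelAxioms → U.RealisationExistsFace → U.Fact_cupExterior → U.Fact_cup_hodge →
      U.Fact_pull_H0 → U.Fact_hodge_F0 → U.Fact_cupAssoc → U.Fact_dimProd → U.Fact_unitH0 → U.Fact_cupAlg := by
  intro h
  obtain ⟨U, M, hR, hN1, hN2, hN3, hN4, h5, hd, hu, h4, -⟩ := descentFactsB₄_realised_all_but_F4_gysinDescentB
  exact h4 (h U M hR hN1 hN2 hN3 hN4 h5 hd hu)

end HodgeCM.ToyG2

end
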